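import Summits.RiemannHypothesis.RiemannHypothesis.Theorems.CCRouteAdapters
import Literature.NumberTheory.ConnesConsani2021.ArchimedeanTraceFormulaProofs
import Literature.NumberTheory.ConnesConsani2021.ProlateProjectionsCompleteness
import Literature.NumberTheory.ConnesConsani2021.SchwartzKernelsHS
import Literature.NumberTheory.ConnesConsani2021.SemilocalTwist
import HarnessLib

/-!
# Route `ConnesConsaniSemilocal`, crux `SoninTraceFormula` (item stmt-RiemannHypothesis-19305):
# the registered stub `stub_deltaEps` — `E_δ(g ∗ g*) = E_ε(g ∗ g*) + Σ_n λ(n)²(1 − λ(n)²)⁻¹ Re⟨ψ_n|ϑ(g ∗ g*)ψ_n⟩`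

RH-FREE (line 1): the integrated form of the identity (chirem3) of the proof of Connes–Consani 2021,
Thm. 4.7 (arXiv:2006.13771 §4 p. 18, chunk p0018:L45–77): "for any test function `f`,
`∫ f(ρ⁻¹)δ(ρ)d*ρ = ∫ f(ρ⁻¹)ε(ρ)d*ρ + Σ λ(n)²⟨ζ_n|ϑ(f)ζ_n⟩`", with `ζ_n = ψ_n/√(1 − λ(n)²)` (Prop. 4.5
(iii)), read for `f = g ∗ g*` and for ANY two functions `Gδ`, `Gε` that agree on `[0, ∞)` with the δ-series
(chirem1) `Σ_n (λ(n)²⟨ξ_n|ϑ(e^{−x})ξ_n⟩ + λ(n)⟨ξ_n|ϑ(e^{−x})ψ_n⟩)` resp. the ε-series (sonine0)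
`Σ_n λ(n)(1 − λ(n)²)⁻¹⟨ξ_n|ϑ(e^{−x})ψ_n⟩` (`evenFunctional G F = ∫ F(x)G(|x|)dx` reads `G` on `[0,∞)` only).
bears_on: W-C/W-P (cell rh-crit, corpus C1; route `route-RiemannHypothesis-ConnesConsaniSemilocal`, binder K1
`SoninTraceFormula`, birth skeleton `SoninTraceFormula_of` = `stub_localTrace` ∘ `stub_deltaEps` (this file),
registered 2026-08-26T04:25:06Z, skeleton sha16 03408a04a1601c88).

**Proof (all inputs are tree THEOREMS — no named fact is used):** the prolate family is unique
(`prolateFamily_unique`), so `ψ = prolateFun` (seat t3); then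
* `Gδ = δ ∘ exp` on `[0, ∞)` is Prop. 4.5 (ii) (chirem1), a theorem since the completeness capstone
  (`CC2021_prop_4_5_ii_of_xi_complete CC2021_sec4_xi_complete_holds`, rows O12/t10), whence
  `E_{Gδ}(F) = D(F) = remainderD F` (`δ(ρ⁻¹) = δ(ρ)`, `traceRemainder_inv`);
* `Gε = ε ∘ exp = epsDensity prolateFun` on `[0, ∞)` (`CCRouteAdapters.epsDensity_eq_routeSeries`, seat g2), whence
  `E_{Gε}(F) = E(F)` (`evenFunctional_congr_Ici`);
* `Σ_n λ(n)² Re⟨ζ_n|ϑ(g ∗ g*)ζ_n⟩ = Re D(g ∗ g*) − Re E(g ∗ g*)` is seat t4's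
  `hasSum_re_soninTraceForm_prolate'` (chirem3 integrated, dominated convergence), fed with the THEOREMS
  `CC2021_prop_4_5_ii_of_xi_complete _`, `CC2021_prop_4_5_iv_holds`, `CC2021_rem_4_6_i_of_xi_complete _`;
* `λ(n)²⟨ζ_n|ϑ(f)ζ_n⟩ = λ(n)²(1 − λ(n)²)⁻¹⟨ψ_n|ϑ(f)ψ_n⟩` (`ζ_n = (1 − λ(n)²)^{-1/2}ψ_n`, `soninTraceForm_smul`,
  `prolatePsi_coeFn`, `|λ(n)| < 1` = `abs_prolateEigen_lt_one`).

WHAT THIS IS NOT: not `stub_localTrace` (the weak local trace formula, whose residual is Prop. 2.2 (iii));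
not a statement about `ζ`, Weil positivity or RH.  Nothing here bears on the truth of RH.
-/

set_option linter.dupNamespace false  -- the mandated namespace repeats `RiemannHypothesis`

noncomputable section

open Set MeasureTheory Filter FourierTransform
open scoped InnerProductSpace ComplexConjugate
open Literature.NumberTheory.LFunctions Literature.NumberTheory.ConnesConsani2021

namespace Summit.RiemannHypothesis.RiemannHypothesis.Theorems.ConnesConsaniSemilocal

/-- RH-FREE. For THE prolate family, the δ-series (chirem1) on `[0, ∞)` IS `δ ∘ exp` — Prop. 4.5 (ii), a tree
theorem since `CC2021_sec4_xi_complete_holds` (the route's inline term is t3's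
`λ(n)²⟨ξ_n|ϑ(ρ⁻¹)ξ_n⟩ + λ(n)⟨ξ_n|ϑ(ρ⁻¹)ψ_n⟩` at `ρ = eˣ`, definitionally).
[cite: ConnesConsani2021, Prop. 4.5 (ii) eq. (chirem1) §4 p. 16 (arXiv Prop. 25)] -/
theorem deltaSeries_eq_traceRemainder {x : ℝ} (hx : 0 ≤ x) :
    ∑' n : ℕ, ((((((∫ v, prolateFun n v) / prolateFun n 0) ^ 2) : ℝ) : ℂ) *
        scalingCoeff (fun v => ((prolateFun n v : ℝ) : ℂ)) (fun v => ((prolateFun n v : ℝ) : ℂ)) (-x) +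
      ((((∫ v, prolateFun n v) / prolateFun n 0) : ℝ) : ℂ) *
        scalingCoeff (fun v => ((prolateFun n v : ℝ) : ℂ))
          (fun v => if 1 ≤ |v| then 𝓕 (fun u : ℝ => ((prolateFun n u : ℝ) : ℂ)) v else 0) (-x)) =
      (traceRemainder (Real.exp x) : ℂ) := by
  have H := CC2021_prop_4_5_ii_of_xi_complete CC2021_sec4_xi_complete_holds (Real.exp x)
    (Real.one_le_exp hx)
  rw [← H.tsum_eq]
  refine tsum_congr fun n => ?_
  rw [repCoeff, repCoeff, Real.log_exp, ← Complex.ofReal_pow]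
  rfl

/-- RH-FREE. Any `Gδ` agreeing with the δ-series on `[0, ∞)` has `E_{Gδ}(F) = D(F) = ∫ F(t)δ(eᵗ)dt`
(`δ(ρ⁻¹) = δ(ρ)`). [cite: ConnesConsani2021, §4 p. 15 ("`D(f) = ∫ f(ρ⁻¹)δ(ρ)d*ρ`"); Prop. 2.2 (ii) §2 p. 10] -/
theorem evenFunctional_eq_remainderD_of_deltaSeries {Gδ : ℝ → ℂ}
    (hδ : ∀ x : ℝ, 0 ≤ x → Gδ x = ∑' n : ℕ, ((((((∫ v, prolateFun n v) / prolateFun n 0) ^ 2) : ℝ) : ℂ) *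
        scalingCoeff (fun v => ((prolateFun n v : ℝ) : ℂ)) (fun v => ((prolateFun n v : ℝ) : ℂ)) (-x) +
      ((((∫ v, prolateFun n v) / prolateFun n 0) : ℝ) : ℂ) *
        scalingCoeff (fun v => ((prolateFun n v : ℝ) : ℂ))
          (fun v => if 1 ≤ |v| then 𝓕 (fun u : ℝ => ((prolateFun n u : ℝ) : ℂ)) v else 0) (-x)))
    (F : ℝ → ℂ) : evenFunctional Gδ F = remainderD F := by
  rw [evenFunctional, remainderD]
  refine integral_congr_ae (Eventually.of_forall fun x => ?_)
  simp only
  rw [hδ |x| (abs_nonneg x), deltaSeries_eq_traceRemainder (abs_nonneg x)]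
  rcases le_or_gt 0 x with hx | hx
  · rw [abs_of_nonneg hx]
  · rw [abs_of_neg hx, Real.exp_neg, traceRemainder_inv]

/-- RH-FREE. `λ(n)²⟨ζ_n|ϑ(f)ζ_n⟩ = λ(n)²(1 − λ(n)²)⁻¹⟨ψ_n|ϑ(f)ψ_n⟩` (real parts), since `ζ_n = ψ_n/√(1 − λ(n)²)`
and the diagonal coefficient is quadratic (`|λ(n)| < 1`, t3's `abs_prolateEigen_lt_one`).
[cite: ConnesConsani2021, Prop. 4.5 (iii) eq. (smaller) §4 p. 16] -/
theorem sq_eigen_mul_re_soninTraceForm_zeta (F : ℝ → ℂ) (n : ℕ) :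
    prolateEigen n ^ 2 * (soninTraceForm F (prolateZeta n)).re =
      prolateEigen n ^ 2 / (1 - prolateEigen n ^ 2) * (soninTraceForm F (prolatePsiFun n)).re := by
  have h1 : 0 < 1 - prolateEigen n ^ 2 := by
    have := abs_lt.1 (abs_prolateEigen_lt_one n)
    nlinarith
  have hc : (starRingEnd ℂ) ((((Real.sqrt (1 - prolateEigen n ^ 2))⁻¹ : ℝ) : ℂ)) *
      ((((Real.sqrt (1 - prolateEigen n ^ 2))⁻¹ : ℝ) : ℂ)) = (((1 - prolateEigen n ^ 2)⁻¹ : ℝ) : ℂ) := by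
    rw [Complex.conj_ofReal, ← Complex.ofReal_mul, ← mul_inv, Real.mul_self_sqrt h1.le]
  rw [prolateZeta, soninTraceForm_smul, hc, soninTraceForm_congr_ae F (prolatePsi_coeFn n),
    Complex.re_ofReal_mul, div_eq_mul_inv]
  ring

/-- **Registered stub `stub_deltaEps`** of the birth skeleton of crux `SoninTraceFormula` (route
`ConnesConsaniSemilocal`, item stmt-RiemannHypothesis-19305), PROVED UNCONDITIONALLY: for every even prolate
family `ψ` (there is exactly one), all `Gδ`, `Gε` agreeing on `[0, ∞)` with the δ-series (chirem1) resp. the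
ε-series (sonine0), and every Weil test `g`,
`Re E_{Gδ}(g ∗ g*) = Re E_{Gε}(g ∗ g*) + Σ_n λ(n)²(1 − λ(n)²)⁻¹ Re⟨ψ_n|ϑ(g ∗ g*)ψ_n⟩` — CC's
"`∫ f(ρ⁻¹)δ(ρ)d*ρ = ∫ f(ρ⁻¹)ε(ρ)d*ρ + Σ λ(n)²⟨ζ_n|ϑ(f)ζ_n⟩`" (chirem3 integrated), `ζ_n = ψ_n/√(1 − λ(n)²)`.
RH-FREE. [cite: ConnesConsani2021, Thm. 4.7 proof §4 p. 18 (arXiv Thm. 27, chunk p0018:L45–77); Prop. 4.5 (ii)–(iv) §4 p. 16] -/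
theorem stub_deltaEps :
    ∀ ψ : ℕ → ℝ → ℝ, (∀ n, IsProlateFunction 1 (2 * n) (ψ n)) → ∀ Gδ Gε : ℝ → ℂ, (∀ x : ℝ, 0 ≤ x → Gδ x = ∑' n : ℕ, ((((((∫ v, ψ n v) / ψ n 0) ^ 2) : ℝ) : ℂ) * scalingCoeff (fun v => ((ψ n v : ℝ) : ℂ)) (fun v => ((ψ n v : ℝ) : ℂ)) (-x) + ((((∫ v, ψ n v) / ψ n 0) : ℝ) : ℂ) * scalingCoeff (fun v => ((ψ n v : ℝ) : ℂ)) (fun v => if 1 ≤ |v| then FourierTransform.fourier (fun u : ℝ => ((ψ n u : ℝ) : ℂ)) v else 0) (-x))) → (∀ x : ℝ, 0 ≤ x → Gε x = ∑' n : ℕ, (((((∫ v, ψ n v) / ψ n 0) / (1 - ((∫ v, ψ n v) / ψ n 0) ^ 2)) : ℝ) : ℂ) * scalingCoeff (fun v => ((ψ n v : ℝ) : ℂ)) (fun v => if 1 ≤ |v| then FourierTransform.fourier (fun u : ℝ => ((ψ n u : ℝ) : ℂ)) v else 0) (-x)) → ∀ g : ℝ → ℂ, IsWeilTest g → (evenFunctional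 Gδ (weilConv g (weilReflect g))).re = (evenFunctional Gε (weilConv g (weilReflect g))).re + ∑' n : ℕ, (((∫ v, ψ n v) / ψ n 0) ^ 2 / (1 - ((∫ v, ψ n v) / ψ n 0) ^ 2)) * (soninTraceForm (weilConv g (weilReflect g)) (fun v => if 1 ≤ |v| then FourierTransform.fourier (fun u : ℝ => ((ψ n u : ℝ) : ℂ)) v else 0)).re := by
  intro ψ hψ Gδ Gε hδ hε g hg
  obtain rfl : ψ = prolateFun := prolateFamily_unique hψ isProlateFunction_prolateFun
  -- `E_{Gδ} = D` and `E_{Gε} = E`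
  have hEδ := evenFunctional_eq_remainderD_of_deltaSeries hδ (weilConv g (weilReflect g))
  have hEε : evenFunctional Gε (weilConv g (weilReflect g)) =
      evenFunctional (epsDensity prolateFun) (weilConv g (weilReflect g)) :=
    evenFunctional_congr_Ici (fun x hx => by rw [hε x hx, CCRouteAdapters.epsDensity_eq_routeSeries prolateFun hx]) _
  -- (chirem3) integrated: `Σ λ(n)² Re⟨ζ_n|ϑ(g ∗ g*)ζ_n⟩ = Re D − Re E`, all inputs theorems
  have hA := hasSum_re_soninTraceForm_prolate'
    (CC2021_prop_4_5_ii_of_xi_complete CC2021_sec4_xi_complete_holds) CC2021_prop_4_5_iv_holds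
    (CC2021_rem_4_6_i_of_xi_complete CC2021_sec4_xi_complete_holds) hg
  have hS := (hA.congr_fun fun n =>
    (sq_eigen_mul_re_soninTraceForm_zeta (weilConv g (weilReflect g)) n).symm).tsum_eq
  rw [hEδ, hEε]
  show (remainderD (weilConv g (weilReflect g))).re =
      (evenFunctional (epsDensity prolateFun) (weilConv g (weilReflect g))).re +
        ∑' n : ℕ, prolateEigen n ^ 2 / (1 - prolateEigen n ^ 2) *
          (soninTraceForm (weilConv g (weilReflect g)) (prolatePsiFun n)).re
  rw [hS]
  ring

end Summit.RiemannHypothesis.RiemannHypothesis.Theorems.ConnesConsaniSemilocal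

end
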